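import Summits.BirchSwinnertonDyer.Rank1Residual.Additive.TameBranchOneValueStickelberger
import Summits.BirchSwinnertonDyer.Rank1Residual.Additive.TwistPartnerTameBranchOfDelbourgo
import HarnessLib

/-!
# ONE NUMBER PER PAIR on the unstarred defect-3/4/6 rows: the one-value certificate fed into
# `CharLamLeAt`, and — with Delbourgo 1998 Thm 1 + 2002 (A)(B)(C) — Schneider and the valuation
# identity at rank one from ONE exact `p`-adic valuation of ONE twisted symbol sum, with NO unit
# root, NO sign certificate, NO Riemann sum (cell `b2b-bsdres`, sub-cell additive-p2 =
# X3♯(G-ord)/X4♯(G-ord), gen 27; part 4/4)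

HONEST FRAMING (cell `b2b-bsdres`, run/shared/lean/b2b/bsd-rank1-residual/, verbatim in every
file): the goal of the cell is to DELETE the COMBINATION-SHAPED residual classes of the
Birch–Swinnerton-Dyer formula for ALL analytic-rank `≤ 1` elliptic curves over `ℚ` — "full BSD
formula for every rank `≤ 1` curve in class `C`" assembled STRICTLY from published theorems — so
that the rank-`≤ 1` remainder becomes exactly the CONSTRUCTION-SHAPED classes, which are TYPED
(missing-input `Prop`s), NOT attempted. This is not "finishing BSD". Sub-cell additive-p2: the
classes X3♯(G-ord) / X4♯(G-ord) are CONSTRUCTION-SHAPED and stay so; labels / RESIDUAL-MAP marks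
UNCHANGED; nothing is booked. Theorems only; the named facts enter as hypothesis binders
(`Delbourgo1998.thm1_exists_bounded_evenMeasure` A282, `Delbourgo2002.mainTheorem` A175,
`Delbourgo2002.thmC_charIdeal_dvd_tameBranch` A227, `Delbourgo2002.mainTheorem_potMult`, GZK).
No definition, no `sorry`.

## What

* §6 **Generic bridge** (`charLamLeAt_of_tameBranchRatDvdAt_of_pow_totient_eq`): the typed Kato
  half `TameBranchRatDvdAt W p` + ANY tame-branch tuple `(f, ε, α, B)` with coefficient bound `p^c` +
  ONE even primitive `p`-power-order `κ` of conductor `p^{n+1+e₀}` with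
  `(p‖τ(ε,ψ_κ)‖‖S(κ)‖)^{φ(pⁿ⁺¹)} = (p^c)^{φ}·p^{−k}`, `k < φ(pⁿ⁺¹)` ⟹ `CharLamLeAt W p k` (every defect,
  (M) included — gen 20/24's discharge with its coefficient input READ OFF ONE VALUE).
* §7 **Defect 3, 4, 6, FIELD-FREE** (`charLamLeAt_of_thm1_of_thmC_of_norm_ratTwistedSymbolSum`): on the
  (G)-ordinary additive locus at `p ≥ 5`, non-CM, `e = semistabilityIndex W p ∈ {3,4,6}`: Delbourgo
  1998 Thm 1 gives SOME bounded branch for SOME `(χ₀, ã₀)` with `χ₀ ∈ {χ, χ⁻¹}` (the two characters of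
  order `e`); designate `χ = ω^u` the Teichmüller power of the SMALL exponent (`eu = p − 1`; a finite
  check on `χ`, no claim about `E`) and supply ONE `κ` with
  **`‖Σ_b κ(b)[b/p^{n+1+e₀}]⁺_f‖^{e·φ} = (p^c)^{e·φ}·p^{−(e·k + φ)}`, `e·k < (e−2)·φ`**: if `χ₀ = χ⁻¹`
  the value contradicts the Gauss bound of its witness (part 3's sign-from-value + gen 26's
  `IsTameBranchOf.mul_norm_tameGaussSum_mul_norm_le`), so `χ₀ = χ` and the one-value certificate gives
  `‖[T^k]B‖ = p^c`, whence `CharLamLeAt W p k` by Delbourgo 2002 (C). NO (G)-field, NO unit root, NO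
  forced partner, NO sign certificate, NO Riemann sum — compare gen 25's
  `charLamLeAt_of_thm1_of_signCert_of_riemannSum` (unit root + sign certificate + Riemann sum).
* §8 **Rank one** (`k = 1`; the side condition `e < (e−2)φ` is automatic at `p ≥ 5`):
  `exists_schneider_rankOne_of_thm1_of_norm_ratTwistedSymbolSum` (+ (A)(B), GZK),
  **`ClassX4Gord.exists_schneider_rankOne_of_thm1_of_norm_ratTwistedSymbolSum`** (Drinfeld–Manin:
  `c = 0`, the datum is **`‖S(κ)‖^{e·φ(pⁿ⁺¹)} = p^{−(e + φ(pⁿ⁺¹))}`**, i.e.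
  `ord_p S(κ) = 1/φ(pⁿ⁺¹) + 1/e` — MET by gen 26's E-GAUSSCERT on the X4 unit unstarred window row
  2450ba1@7 at conductor `7²`: `ord_7 S(κ₁) = 1/6 + 1/3`), the X3♯(G-ord) twin with the bound `p^c`, and
  **`ClassX4Gord.padicVal_identity_rankOne_of_thm1_of_norm_ratTwistedSymbolSum`**: Schneider,
  `#Ш[p^∞] < ∞`, `λ(fE) = 1`, `ord Ш[p^∞] + ord Reg_p + ord ∏c + ord ℓ = μ(fE) + 1 + 2 ord #tors`.
* §9 **Starred rows / the sign known otherwise** (`charLamLeAt_of_thm1_of_signCert_of_pow_totient_eq`):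
  gen 25's setting (unit root `ã`, sign certificate against `χ⁻¹`) with the Riemann sum replaced by the
  one value `(p‖τ(ι∘χ,ψ_κ)‖‖S(κ)‖)^{φ} = (p^c)^{φ}·p^{−k}`.

Not claimed: `μ`; the LOWER half; which Teichmüller power is bounded on which Kodaira type (if
`χ = ω^u` is not the bounded character of the pair, the hypothesis on `S(κ)` is never met); any booking.

References: Delbourgo 1998 Thm. 1 [Delbourgo1998]; Delbourgo 2002 Thm. (A)(B)(C) [Delbourgo2002]; Lang
Ch. 1 §2 Thm. 2.1 [Lang1990]; MTT 1986 §I.8, §I.13–I.14 [MazurTateTeitelbaum1986Invent]; [Manin1972]. -/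

set_option autoImplicit false

noncomputable section

open scoped Classical MatrixGroups ModularForm NumberField

open CongruenceSubgroup IsDedekindDomain WeierstrassCurve NumberField
  Literature.NumberTheory.EllipticCurves
  Literature.NumberTheory.EllipticCurves.ModularForms
  Literature.NumberTheory.EllipticCurves.Rank1Residual
  Literature.NumberTheory.EllipticCurves.Rank1Residual.Typed
  Literature.NumberTheory.EllipticCurves.Delbourgo2002
  Summit.BirchSwinnertonDyer.Rank1Residual.X1.MuLambda
  Summit.BirchSwinnertonDyer.Rank1Residual.X11a.LambdaNorm

namespace Summit.BirchSwinnertonDyer.Rank1Residual.Additive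

/-! ### §6 Generic bridge: one value ⟹ `CharLamLeAt W p k` (every defect) -/

section Generic

variable {W : WeierstrassCurve ℚ} [W.IsElliptic] [W.IsGloballyMinimal] {p : ℕ} [hp : Fact p.Prime]
  {N : ℕ} [NeZero N] {f : CuspForm (Gamma0 N) 2}

/-- **`CharLamLeAt W p k` from the typed Kato half and ONE VALUE.** `p ≠ 2` additive of type (M) or
(G-ord), the typed input `TameBranchRatDvdAt W p` (Delbourgo 2002 (C)), a tame-branch tuple
`(f, ε, α, B)` with `IsTameBranchOf f p ε α B`, `‖α‖ = 1`, coefficient bound `p^c`, and ONE even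
primitive `p`-power-order `κ` of conductor `p^{n+1+e₀}` with
`(p‖τ(ε,ψ_κ)‖‖Σ_b κ(b)[b/p^{n+1+e₀}]⁺_f‖)^{φ(pⁿ⁺¹)} = (p^c)^{φ(pⁿ⁺¹)}·p^{−k}`, `k < φ(pⁿ⁺¹)`: then every
generator of `char_Λ X(W/ℚ_∞)` for every cyclotomic dual datum has `λ ≤ k`.
[cite: Delbourgo2002, Theorem (C) (p. 40)] [cite: MazurTateTeitelbaum1986Invent, §I.8, §I.13–I.14]
[cite: Washington1997, §7.1–7.2] -/
theorem charLamLeAt_of_tameBranchRatDvdAt_of_pow_totient_eq (hT : TameBranchRatDvdAt W p)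
    {ε : DirichletCharacter ℂ_[p] p} {α : ℚ_[p]} {B : PowerSeries ℚ_[p]}
    (hp2 : p ≠ 2) (hadd : Addv W p) (hloc : PotMult W p ∨ TypeGOrd W p)
    (hf : IsNewformOf W f) (hε : orderOf ε = tameDefect W p) (hα : ‖α‖ = 1)
    (hB : IsTameBranchOf f p ε α B) {c : ℕ} (hbd : ∀ j : ℕ, ‖PowerSeries.coeff j B‖ ≤ (p : ℝ) ^ c)
    {n : ℕ} {κ : DirichletCharacter ℂ_[p] (p ^ (n + 1 + cyclotomicExponent p))} (hκ : κ.IsPrimitive)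
    (heven : κ.Even) (hord : ∃ j : ℕ, orderOf κ = p ^ j) {k : ℕ} (hkφ : k < Nat.totient (p ^ (n + 1)))
    (hval : ((p : ℝ) * ‖tameGaussSum p ε κ‖ * ‖ratTwistedSymbolSum f κ‖) ^ Nat.totient (p ^ (n + 1)) =
      ((p : ℝ) ^ c) ^ Nat.totient (p ^ (n + 1)) * ((p : ℝ)⁻¹) ^ k) :
    CharLamLeAt W p k :=
  charLamLeAt_of_tameBranchRatDvdAt_of_norm_le_pow_of_norm_coeff_eq_pow hT hp2 hadd hloc hf hε hα hB
    hbd (hB.firstTop_of_pow_totient_eq hα hbd hκ heven hord hkφ hval).1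

end Generic

/-! ### §7 Defect 3, 4, 6: `CharLamLeAt` from print and ONE VALUE — no field, no unit root, no sign
certificate, no Riemann sum -/

namespace TwistPartner

section FieldFree

variable {W : WeierstrassCurve ℚ} [W.IsElliptic] [W.IsGloballyMinimal] {p : ℕ} [hp : Fact p.Prime]
  {N : ℕ} [NeZero N] {f : CuspForm (Gamma0 N) 2} {χ : MulChar (ZMod p) ℚ_[p]}

/-- `e·k < (e−2)·φ ⟹ k < φ`. [folklore] -/
theorem lt_of_mul_lt_sub_two_mul {e k φ : ℕ} (h : e * k < (e - 2) * φ) : k < φ := by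
  by_contra hle
  rw [not_lt] at hle
  have h1 : (e - 2) * φ ≤ e * k :=
    le_trans (Nat.mul_le_mul_right _ (Nat.sub_le e 2)) (Nat.mul_le_mul_left _ hle)
  omega

/-- **`CharLamLeAt W p k` FROM PRINT AND ONE VALUE (defect 3, 4, 6; field-free).** `p ≥ 5`, `E = W`
non-CM, ADDITIVE, (G)-ordinary, `e = semistabilityIndex W p ∈ {3,4,6}`, newform `f`; `χ` a character of
`ℤ/p` (values in `ℚ_p`) of order `e` which is the Teichmüller power of the SMALL exponent `u`,
`eu = p − 1` (`‖χ(a) − a^u‖_p < 1`); a tower bound `‖[a/p^m]⁺_f‖_p ≤ p^c`; ONE even primitive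
`p`-power-order `κ` of conductor `p^{n+1+e₀}` with
**`‖Σ_b κ(b)[b/p^{n+1+e₀}]⁺_f‖_p^{e·φ(pⁿ⁺¹)} = (p^c)^{e·φ}·p^{−(e·k + φ)}`** and **`e·k < (e−2)·φ(pⁿ⁺¹)`**.
Then `CharLamLeAt W p k`. Mechanism: Delbourgo 1998 Thm 1 gives a bounded branch `B` for some
`(χ₀, ã₀)`, `χ₀ ∈ {χ, χ⁻¹}`; `χ₀ = χ⁻¹` is refuted by the value (Stickelberger: the conjugate Gauss sum
is too large for a witness bounded by `p^c`); for `χ₀ = χ` the one-value certificate reads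
`‖[T^k]B‖ = p^c` and Delbourgo 2002 (C) bounds `λ`. NO (G)-field, unit root, forced partner, sign
certificate or Riemann sum is supplied. Nothing booked.
[cite: Delbourgo1998, Theorem 1 (p. 131)] [cite: Delbourgo2002, Theorem (A), (C) (p. 40)]
[cite: Lang1990, Ch. 1 §2 Thm. 2.1] [cite: MazurTateTeitelbaum1986Invent, §I.8, §I.13–I.14] -/
theorem charLamLeAt_of_thm1_of_thmC_of_norm_ratTwistedSymbolSum
    (hD : Delbourgo1998.thm1_exists_bounded_evenMeasure)
    (hC : Delbourgo2002.thmC_charIdeal_dvd_tameBranch) (hDel : Delbourgo2002.mainTheorem)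
    (hDelM : Delbourgo2002.mainTheorem_potMult) (h5 : 5 ≤ p) (hcm : ¬ W.HasCM) (hadd : Addv W p)
    (hGord : TypeGOrd W p) (he : semistabilityIndex W p ∈ ({3, 4, 6} : Finset ℕ))
    (hf : IsNewformOf W f) (hχe : orderOf χ = semistabilityIndex W p) {u : ℕ}
    (hu : semistabilityIndex W p * u = p - 1)
    (hteich : ∀ a : ZMod p, a ≠ 0 → ‖χ a - ((a.val : ℕ) : ℚ_[p]) ^ u‖ < 1) {c : ℕ}
    (hc : ∀ (m : ℕ) (a : ℤ), ‖((ratPlusSymbol f ((a : ℚ) / (p : ℚ) ^ m) : ℚ) : ℚ_[p])‖ ≤ (p : ℝ) ^ c)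
    {n : ℕ} {κ : DirichletCharacter ℂ_[p] (p ^ (n + 1 + cyclotomicExponent p))} (hκ : κ.IsPrimitive)
    (heven : κ.Even) (hord : ∃ j : ℕ, orderOf κ = p ^ j) {k : ℕ}
    (hke : semistabilityIndex W p * k < (semistabilityIndex W p - 2) * Nat.totient (p ^ (n + 1)))
    (hval : ‖ratTwistedSymbolSum f κ‖ ^ (semistabilityIndex W p * Nat.totient (p ^ (n + 1))) =
      ((p : ℝ) ^ c) ^ (semistabilityIndex W p * Nat.totient (p ^ (n + 1))) *
        ((p : ℝ)⁻¹) ^ (semistabilityIndex W p * k + Nat.totient (p ^ (n + 1)))) :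
    CharLamLeAt W p k := by
  have hp2 : p ≠ 2 := by omega
  have h2 : 2 ≤ semistabilityIndex W p := by
    simp only [Finset.mem_insert, Finset.mem_singleton] at he; omega
  have hG : SubGord W p := (subGord_iff_typeG_of_addv W p hp2 hadd).mpr hGord.typeG
  have hT : TameBranchRatDvdAt W p := tameBranchRatDvdAt_of_thmC hC hDel hDelM h5 hcm
  obtain ⟨χ₀, ã₀, B, hord0, hã₀, hB, hint⟩ := exists_isTameBranchOf_of_thm1 hD h5 hadd hGord he hf
  have hbd : ∀ j : ℕ, ‖PowerSeries.coeff j B‖ ≤ (p : ℝ) ^ c := hint _ hc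
  have hkφ : k < Nat.totient (p ^ (n + 1)) := lt_of_mul_lt_sub_two_mul hke
  have hord0' : orderOf χ₀ = semistabilityIndex W p := by
    have h := hord0
    rwa [orderOf_ringHomComp_padicComplex, tameDefect_of_not_potMult W p hG.1] at h
  rcases eq_or_eq_inv_of_orderOf_eq he hχe hord0' with h0 | h0
  · subst h0
    have hk := (hB.firstTop_of_norm_ratTwistedSymbolSum_pow_eq hã₀ hbd hteich hχe h2 hu hκ heven hord
      hkφ hval).1
    exact charLamLeAt_of_tameBranchRatDvdAt_of_norm_le_pow_of_norm_coeff_eq_pow hT hp2 hadd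
      (Or.inr hGord) hf hord0 hã₀ hB hbd hk
  · exfalso
    subst h0
    have hlt := lt_mul_norm_tameGaussSum_inv_mul_norm_of_pow_eq (f := f) hteich hχe h2 hu hκ hke hval
    have hle := hB.mul_norm_tameGaussSum_mul_norm_le hã₀ hbd (two_le_add_one_add_cyclotomicExponent n)
      hκ heven hord
    exact (lt_irrefl _) (hlt.trans_le hle)

/-! ### §8 Rank one: Schneider and the valuation identity from ONE NUMBER per pair -/

/-- At `p ≥ 5` and `e ∈ {3,4,6}`: `e·1 < (e−2)·φ(pⁿ⁺¹)` (`φ(pⁿ⁺¹) ≥ p − 1 ≥ 4`). [folklore] -/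
theorem mul_one_lt_sub_two_mul_totient (h5 : 5 ≤ p) {e : ℕ} (he : e ∈ ({3, 4, 6} : Finset ℕ))
    (n : ℕ) : e * 1 < (e - 2) * Nat.totient (p ^ (n + 1)) := by
  have hφ : p - 1 ≤ Nat.totient (p ^ (n + 1)) := by
    rw [Nat.totient_prime_pow_succ hp.out]
    exact Nat.le_mul_of_pos_left _ (pow_pos hp.out.pos n)
  simp only [Finset.mem_insert, Finset.mem_singleton] at he
  rcases he with rfl | rfl | rfl <;> omega

/-- **`ord_{s=1}L(E,s) = 1`: Schneider for Delbourgo's datum FROM PRINT AND ONE NUMBER** (defect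
3, 4, 6, field-free): Delbourgo 1998 Thm 1, 2002 (A)(B)(C), GZK + `χ = ω^u` of order `e` + the plus-symbol
bound `p^c` + ONE `κ` of conductor `p^{n+1+e₀}` with **`‖S(κ)‖^{e·φ} = (p^c)^{e·φ}·p^{−(e + φ)}`** ⟹
Schneider's conjecture for every (B)-datum, and some (B)-datum exists. [cite: Delbourgo1998, Theorem 1 (p. 131)]
[cite: Delbourgo2002, Theorem (A), (B), (C) (p. 40)] [cite: Lang1990, Ch. 1 §2 Thm. 2.1] -/
theorem exists_schneider_rankOne_of_thm1_of_norm_ratTwistedSymbolSum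
    (hD : Delbourgo1998.thm1_exists_bounded_evenMeasure)
    (hC : Delbourgo2002.thmC_charIdeal_dvd_tameBranch) (hDel : Delbourgo2002.mainTheorem)
    (hDelM : Delbourgo2002.mainTheorem_potMult) (hGZK : rank_eq_analyticRank_of_analyticRank_le_one)
    (h5 : 5 ≤ p) (hcm : ¬ W.HasCM) (hadd : Addv W p) (hGord : TypeGOrd W p)
    (he : semistabilityIndex W p ∈ ({3, 4, 6} : Finset ℕ)) (hr : W.analyticRank = 1)
    (hf : IsNewformOf W f) (hχe : orderOf χ = semistabilityIndex W p) {u : ℕ}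
    (hu : semistabilityIndex W p * u = p - 1)
    (hteich : ∀ a : ZMod p, a ≠ 0 → ‖χ a - ((a.val : ℕ) : ℚ_[p]) ^ u‖ < 1) {c : ℕ}
    (hc : ∀ (m : ℕ) (a : ℤ), ‖((ratPlusSymbol f ((a : ℚ) / (p : ℚ) ^ m) : ℚ) : ℚ_[p])‖ ≤ (p : ℝ) ^ c)
    {n : ℕ} {κ : DirichletCharacter ℂ_[p] (p ^ (n + 1 + cyclotomicExponent p))} (hκ : κ.IsPrimitive)
    (heven : κ.Even) (hord : ∃ j : ℕ, orderOf κ = p ^ j)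
    (hval : ‖ratTwistedSymbolSum f κ‖ ^ (semistabilityIndex W p * Nat.totient (p ^ (n + 1))) =
      ((p : ℝ) ^ c) ^ (semistabilityIndex W p * Nat.totient (p ^ (n + 1))) *
        ((p : ℝ)⁻¹) ^ (semistabilityIndex W p + Nat.totient (p ^ (n + 1)))) :
    (∀ Dh : PAdicHeightData W p, LeadingTermClauses W p Dh → SchneiderConjecture Dh) ∧
      ∃ Dh : PAdicHeightData W p, LeadingTermClauses W p Dh ∧ SchneiderConjecture Dh := by
  have hke := mul_one_lt_sub_two_mul_totient h5 he n
  have hlam1 : CharLamLeAt W p 1 :=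
    charLamLeAt_of_thm1_of_thmC_of_norm_ratTwistedSymbolSum hD hC hDel hDelM h5 hcm hadd hGord he hf hχe
      hu hteich hc hκ heven hord hke (by rw [mul_one]; exact hval)
  obtain ⟨hmw, -⟩ := hGZK W (by rw [hr])
  have hr1 : W.mordellWeilRank = 1 := by rw [hmw, hr]
  have hlam : CharLamLeAt W p W.mordellWeilRank := by rw [hr1]; exact hlam1
  have hA : ∀ (κ' : ZpExtension ℚ p) (γ : Field.absoluteGaloisGroup ℚ),
      κ'.IsCyclotomic → κ'.IsTopGenerator γ → ∀ D : W.SelmerDualData κ' γ, D.IsTorsion :=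
    fun _ _ hκ' hγ D ↦ Delbourgo2002.mainTheorem.isTorsion hDel h5 hcm hadd hGord hκ' hγ D
  have hS : ∀ Dh : PAdicHeightData W p, LeadingTermClauses W p Dh → SchneiderConjecture Dh :=
    fun Dh hBcl ↦ (schneider_and_finite_of_charLamLe W p hBcl hA hlam).1
  obtain ⟨Dh, hBcl⟩ := Delbourgo2002.mainTheorem.exists_leadingTermClauses hDel h5 hcm hadd hGord
  exact ⟨hS, Dh, hBcl, hS Dh hBcl⟩

/-- **X4♯(G-ord), defect 3, 4, 6, `ord_{s=1}L(E,s) = 1`, `p ≥ 5`, non-CM — SCHNEIDER FROM PRINTED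
FACTS AND ONE NUMBER.** Printed: Delbourgo 1998 Thm. 1; Delbourgo 2002 (A), (B), (C); GZK;
Drinfeld–Manin integrality on X4 (`c = 0`). Per pair: a character `χ = ω^u` of `ℤ/p` of order
`e = semistabilityIndex W p` (`eu = p − 1`; a finite check on `χ`) and ONE even primitive
`p`-power-order `κ` of conductor `p^{n+1+e₀}` with **`‖Σ_b κ(b)[b/p^{n+1+e₀}]⁺_f‖_p^{e·φ(pⁿ⁺¹)} =
p^{−(e + φ(pⁿ⁺¹))}`**, i.e. `ord_p S(κ) = 1/φ(pⁿ⁺¹) + 1/e` — then Schneider's conjecture holds for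
every (B)-datum. NO (G)-field, NO unit root, NO sign certificate, NO Riemann sum (gen 25 needed all
three). The datum is MET by E-GAUSSCERT (gen 26) on 2450ba1@7 at conductor `7²` (`ord_7 S = 1/2`).
Nothing booked; X4♯(G-ord) stays CONSTRUCTION-SHAPED. [cite: Delbourgo1998, Theorem 1 (p. 131)]
[cite: Delbourgo2002, Theorem (A), (B), (C) (p. 40)] [cite: Manin1972, Cor. 3.6]
[cite: Lang1990, Ch. 1 §2 Thm. 2.1] -/
theorem ClassX4Gord.exists_schneider_rankOne_of_thm1_of_norm_ratTwistedSymbolSum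
    (hD : Delbourgo1998.thm1_exists_bounded_evenMeasure)
    (hC : Delbourgo2002.thmC_charIdeal_dvd_tameBranch) (hDel : Delbourgo2002.mainTheorem)
    (hDelM : Delbourgo2002.mainTheorem_potMult) (hGZK : rank_eq_analyticRank_of_analyticRank_le_one)
    (hX : ClassX4Gord W p) (h5 : 5 ≤ p) (hcm : ¬ W.HasCM)
    (he : semistabilityIndex W p ∈ ({3, 4, 6} : Finset ℕ)) (hr : W.analyticRank = 1)
    (hf : IsNewformOf W f) (hχe : orderOf χ = semistabilityIndex W p) {u : ℕ}
    (hu : semistabilityIndex W p * u = p - 1)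
    (hteich : ∀ a : ZMod p, a ≠ 0 → ‖χ a - ((a.val : ℕ) : ℚ_[p]) ^ u‖ < 1)
    {n : ℕ} {κ : DirichletCharacter ℂ_[p] (p ^ (n + 1 + cyclotomicExponent p))} (hκ : κ.IsPrimitive)
    (heven : κ.Even) (hord : ∃ j : ℕ, orderOf κ = p ^ j)
    (hval : ‖ratTwistedSymbolSum f κ‖ ^ (semistabilityIndex W p * Nat.totient (p ^ (n + 1))) =
      ((p : ℝ)⁻¹) ^ (semistabilityIndex W p + Nat.totient (p ^ (n + 1)))) :
    (∀ Dh : PAdicHeightData W p, LeadingTermClauses W p Dh → SchneiderConjecture Dh) ∧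
      ∃ Dh : PAdicHeightData W p, LeadingTermClauses W p Dh ∧ SchneiderConjecture Dh := by
  have hc : ∀ (m : ℕ) (a : ℤ),
      ‖((ratPlusSymbol f ((a : ℚ) / (p : ℚ) ^ m) : ℚ) : ℚ_[p])‖ ≤ (p : ℝ) ^ (0 : ℕ) := fun m a ↦ by
    rw [pow_zero]
    exact plusSymbolsPIntegralAt_of_classX4 W p hX.1 f hf _
  exact TwistPartner.exists_schneider_rankOne_of_thm1_of_norm_ratTwistedSymbolSum hD hC hDel hDelM
    hGZK h5 hcm hX.addv.2 hX.typeGOrd he hr hf hχe hu hteich hc hκ heven hord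
    (by rw [pow_zero, one_pow, one_mul]; exact hval)

/-- **X3♯(G-ord), defect 3, 4, 6, `ord_{s=1}L(E,s) = 1`, `p ≥ 5`, non-CM** — the twin with the tower
bound `p^c` of the plus symbols: printed facts + `χ = ω^u` + ONE `κ` with
`‖S(κ)‖^{e·φ} = (p^c)^{e·φ}·p^{−(e + φ)}` ⟹ Schneider for Delbourgo's datum. Nothing booked; X3♯(G-ord)
CONSTRUCTION-SHAPED. [cite: Delbourgo1998, Theorem 1 (p. 131)]
[cite: Delbourgo2002, Theorem (A), (B), (C) (p. 40)] [cite: Lang1990, Ch. 1 §2 Thm. 2.1] -/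
theorem ClassX3Gord.exists_schneider_rankOne_of_thm1_of_norm_ratTwistedSymbolSum
    (hD : Delbourgo1998.thm1_exists_bounded_evenMeasure)
    (hC : Delbourgo2002.thmC_charIdeal_dvd_tameBranch) (hDel : Delbourgo2002.mainTheorem)
    (hDelM : Delbourgo2002.mainTheorem_potMult) (hGZK : rank_eq_analyticRank_of_analyticRank_le_one)
    (hX : ClassX3Gord W p) (h5 : 5 ≤ p) (hcm : ¬ W.HasCM)
    (he : semistabilityIndex W p ∈ ({3, 4, 6} : Finset ℕ)) (hr : W.analyticRank = 1)
    (hf : IsNewformOf W f) (hχe : orderOf χ = semistabilityIndex W p) {u : ℕ}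
    (hu : semistabilityIndex W p * u = p - 1)
    (hteich : ∀ a : ZMod p, a ≠ 0 → ‖χ a - ((a.val : ℕ) : ℚ_[p]) ^ u‖ < 1) {c : ℕ}
    (hc : ∀ (m : ℕ) (a : ℤ), ‖((ratPlusSymbol f ((a : ℚ) / (p : ℚ) ^ m) : ℚ) : ℚ_[p])‖ ≤ (p : ℝ) ^ c)
    {n : ℕ} {κ : DirichletCharacter ℂ_[p] (p ^ (n + 1 + cyclotomicExponent p))} (hκ : κ.IsPrimitive)
    (heven : κ.Even) (hord : ∃ j : ℕ, orderOf κ = p ^ j)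
    (hval : ‖ratTwistedSymbolSum f κ‖ ^ (semistabilityIndex W p * Nat.totient (p ^ (n + 1))) =
      ((p : ℝ) ^ c) ^ (semistabilityIndex W p * Nat.totient (p ^ (n + 1))) *
        ((p : ℝ)⁻¹) ^ (semistabilityIndex W p + Nat.totient (p ^ (n + 1)))) :
    (∀ Dh : PAdicHeightData W p, LeadingTermClauses W p Dh → SchneiderConjecture Dh) ∧
      ∃ Dh : PAdicHeightData W p, LeadingTermClauses W p Dh ∧ SchneiderConjecture Dh :=
  TwistPartner.exists_schneider_rankOne_of_thm1_of_norm_ratTwistedSymbolSum hD hC hDel hDelM hGZK h5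
    hcm hX.addv hX.typeGOrd he hr hf hχe hu hteich hc hκ heven hord hval

/-- **X4♯(G-ord), defect 3, 4, 6, `rank E(ℚ) = 1`, `p ≥ 5`, non-CM — THE VALUATION IDENTITY FROM
PRINTED FACTS AND ONE NUMBER** (Delbourgo 1998 Thm 1; Delbourgo 2002 (A), (B), (C); Drinfeld–Manin on
X4; `χ = ω^u` of order `e`; ONE `κ` with `‖S(κ)‖^{e·φ} = p^{−(e+φ)}`): for every (B)-datum `Dh` and
every Pontryagin-dual datum with `char = (fE)`: Schneider, `#Ш[p^∞] < ∞`, `λ(fE) = 1`, and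
`ord Ш[p^∞] + ord Reg_p(Dh) + ord ∏c + ord ℓ = μ(fE) + 1 + 2 ord #E(ℚ)_tors`, `ℓ ∣ p²`, `ℓ = 1` off the
anomalous rows — gen 25's `…_of_signCert_of_riemannSum` with its three finite inputs replaced by ONE.
Nothing booked. [cite: Delbourgo1998, Theorem 1 (p. 131)]
[cite: Delbourgo2002, Theorem (A), (B), (C) (p. 40)] [cite: Manin1972, Cor. 3.6] [cite: Lang1990, Ch. 1 §2 Thm. 2.1] -/
theorem ClassX4Gord.padicVal_identity_rankOne_of_thm1_of_norm_ratTwistedSymbolSum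
    (hD : Delbourgo1998.thm1_exists_bounded_evenMeasure)
    (hC : Delbourgo2002.thmC_charIdeal_dvd_tameBranch) (hDel : Delbourgo2002.mainTheorem)
    (hDelM : Delbourgo2002.mainTheorem_potMult) (hX : ClassX4Gord W p) (h5 : 5 ≤ p) (hcm : ¬ W.HasCM)
    (he : semistabilityIndex W p ∈ ({3, 4, 6} : Finset ℕ)) (hrk : W.mordellWeilRank = 1)
    (hf : IsNewformOf W f) (hχe : orderOf χ = semistabilityIndex W p) {u : ℕ}
    (hu : semistabilityIndex W p * u = p - 1)
    (hteich : ∀ a : ZMod p, a ≠ 0 → ‖χ a - ((a.val : ℕ) : ℚ_[p]) ^ u‖ < 1)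
    {n : ℕ} {κ : DirichletCharacter ℂ_[p] (p ^ (n + 1 + cyclotomicExponent p))} (hκ : κ.IsPrimitive)
    (heven : κ.Even) (hord : ∃ j : ℕ, orderOf κ = p ^ j)
    (hval : ‖ratTwistedSymbolSum f κ‖ ^ (semistabilityIndex W p * Nat.totient (p ^ (n + 1))) =
      ((p : ℝ)⁻¹) ^ (semistabilityIndex W p + Nat.totient (p ^ (n + 1))))
    {Dh : PAdicHeightData W p} (hBcl : LeadingTermClauses W p Dh)
    {K : ZpExtension ℚ p} {γ : Field.absoluteGaloisGroup ℚ}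
    (hK : K.IsCyclotomic) (hγ : K.IsTopGenerator γ) (hcv : IsCyclotomicVariable p γ)
    (D : W.SelmerDualData K γ) [Module.Finite (IwasawaAlgebra p) D.X]
    {fE : IwasawaAlgebra p} (hchar : D.charIdeal = Ideal.span {fE}) :
    SchneiderConjecture Dh ∧ Finite (AddCommGroup.primaryComponent W.sha p) ∧
      X1.MuLambda.lam fE = 1 ∧
      ∃ ℓ : ℕ, ℓ ∣ p ^ 2 ∧ (ReductionNonAnomalous W p → ℓ = 1) ∧
        (padicValNat p (Nat.card (AddCommGroup.primaryComponent W.sha p)) : ℤ) +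
            (padicRegulator Dh).valuation + padicValNat p W.tamagawaProduct + padicValNat p ℓ =
          X1.MuLambda.mu fE + 1 + 2 * padicValNat p W.torsionOrder := by
  have hp2 : p ≠ 2 := by omega
  have hadd : Addv W p := hX.addv.2
  have hGord : TypeGOrd W p := hX.typeGOrd
  have hc : ∀ (m : ℕ) (a : ℤ),
      ‖((ratPlusSymbol f ((a : ℚ) / (p : ℚ) ^ m) : ℚ) : ℚ_[p])‖ ≤ (p : ℝ) ^ (0 : ℕ) := fun m a ↦ by
    rw [pow_zero]
    exact plusSymbolsPIntegralAt_of_classX4 W p hX.1 f hf _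
  have hke := mul_one_lt_sub_two_mul_totient h5 he n
  have hlam1 : CharLamLeAt W p 1 :=
    TwistPartner.charLamLeAt_of_thm1_of_thmC_of_norm_ratTwistedSymbolSum hD hC hDel hDelM h5 hcm hadd
      hGord he hf hχe hu hteich hc hκ heven hord hke
      (by rw [pow_zero, one_pow, one_mul, mul_one]; exact hval)
  have hXt : D.IsTorsion := Delbourgo2002.mainTheorem.isTorsion hDel h5 hcm hadd hGord hK hγ D
  have h := padicVal_identity_of_charLamLe W p hBcl hp2 hK hγ hcv D hXt hchar
    (by rw [hrk]; exact hlam1 K γ hK hγ hcv D fE hchar)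
  rw [hrk] at h
  obtain ⟨hS, hfin, hlam, ℓ, hℓ, hna, hid⟩ := h
  exact ⟨hS, hfin, hlam, ℓ, hℓ, hna, by exact_mod_cast hid⟩

end FieldFree

/-! ### §9 The sign known otherwise (starred rows): gen 25's join with the Riemann sum replaced by
the one value -/

section SignCert

variable {W : WeierstrassCurve ℚ} [W.IsElliptic] [W.IsGloballyMinimal] {p : ℕ} [hp : Fact p.Prime]
  {N : ℕ} [NeZero N] {f : CuspForm (Gamma0 N) 2} {χ : MulChar (ZMod p) ℚ_[p]} {ã : ℚ_[p]}

/-- **`CharLamLeAt W p k` from print + unit root + sign certificate + ONE VALUE** (general locus: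
`p ≥ 5`, ADDITIVE, (G)-ORDINARY, `e ∈ {3,4,6}`, non-CM; for STARRED rows, where the value alone does
not decide the sign): Delbourgo 1998 Thm. 1 + 2002 (A)(C) + a (G)-field `F` with `w ∣ p` and the unit
root `ã` + `χ` of order `e` + plus-symbol bound `p^c` + gen 25's SIGN CERTIFICATE
`p^c < ‖forced χ⁻¹ [·]⁺_f ã (a₀/p^{n₀})‖_p` + ONE even primitive `p`-power-order `κ` of conductor
`p^{n+1+e₀}` with `(p‖τ(ι∘χ,ψ_κ)‖‖S(κ)‖)^{φ} = (p^c)^{φ}·p^{−k}`, `k < φ` (for `χ = ω^{(e−1)u}` this is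
`‖S(κ)‖^{e·φ} = (p^c)^{e·φ}·p^{−(e·k+(e−1)φ)}` by part 3) ⟹ `CharLamLeAt W p k` — gen 25's
`charLamLeAt_of_thm1_of_signCert_of_riemannSum` with the Riemann sum REPLACED by one twisted symbol
sum. Nothing booked. [cite: Delbourgo1998, Theorem 1 (p. 131)] [cite: Delbourgo2002, Theorem (A), (C) (p. 40)]
[cite: MazurTateTeitelbaum1986Invent, §I.8, §I.13–I.14] -/
theorem charLamLeAt_of_thm1_of_signCert_of_pow_totient_eq
    (hD : Delbourgo1998.thm1_exists_bounded_evenMeasure)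
    (hC : Delbourgo2002.thmC_charIdeal_dvd_tameBranch) (hDel : Delbourgo2002.mainTheorem)
    (hDelM : Delbourgo2002.mainTheorem_potMult) (h5 : 5 ≤ p) (hcm : ¬ W.HasCM) (hadd : Addv W p)
    (hGord : TypeGOrd W p) (he : semistabilityIndex W p ∈ ({3, 4, 6} : Finset ℕ))
    (hf : IsNewformOf W f)
    {L : Type} [Field L] [NumberField L] [IsCyclotomicExtension {p} ℚ L] (F : IntermediateField ℚ L)
    (hF : ∀ w : HeightOneSpectrum (𝓞 F), (p : 𝓞 F) ∈ w.asIdeal →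
      (W.baseChange F).HasGoodReductionAt w ∧ (W.baseChange F).HasUnitRootAt w)
    (w : HeightOneSpectrum (𝓞 F)) (hw : (p : 𝓞 F) ∈ w.asIdeal)
    (hã : ‖ã‖ = 1) (hroot : ã ^ 2 - (((W.baseChange F).frobeniusTraceAt w : ℤ) : ℚ_[p]) * ã + p = 0)
    (hχe : orderOf χ = semistabilityIndex W p) {c : ℕ}
    (hc : ∀ (m : ℕ) (a : ℤ), ‖((ratPlusSymbol f ((a : ℚ) / (p : ℚ) ^ m) : ℚ) : ℚ_[p])‖ ≤ (p : ℝ) ^ c)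
    (hsign : ∃ (n₀ : ℕ) (a₀ : ℤ), (p : ℝ) ^ c <
      ‖TwistPartner.forced χ⁻¹ (fun r ↦ ((ratPlusSymbol f r : ℚ) : ℚ_[p])) ã ((a₀ : ℚ) / (p : ℚ) ^ n₀)‖)
    {n : ℕ} {κ : DirichletCharacter ℂ_[p] (p ^ (n + 1 + cyclotomicExponent p))} (hκ : κ.IsPrimitive)
    (heven : κ.Even) (hord : ∃ j : ℕ, orderOf κ = p ^ j) {k : ℕ} (hkφ : k < Nat.totient (p ^ (n + 1)))
    (hval : ((p : ℝ) * ‖tameGaussSum p (χ.ringHomComp (algebraMap ℚ_[p] ℂ_[p])) κ‖ *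
        ‖ratTwistedSymbolSum f κ‖) ^ Nat.totient (p ^ (n + 1)) =
      ((p : ℝ) ^ c) ^ Nat.totient (p ^ (n + 1)) * ((p : ℝ)⁻¹) ^ k) :
    CharLamLeAt W p k := by
  have hp2 : p ≠ 2 := by omega
  have hG : SubGord W p := (subGord_iff_typeG_of_addv W p hp2 hadd).mpr hGord.typeG
  obtain ⟨C₀, hC₀⟩ := towerBounded_forced_of_thm1_of_signCert hD h5 hadd he hf F hF w hw hã hroot hχe
    hc hsign
  have hne : χ ≠ 1 := by
    intro h
    rw [h, orderOf_one] at hχe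
    simp only [Finset.mem_insert, Finset.mem_singleton] at he
    omega
  have hU0 := sum_ratPlusSymbol_add_div_eq_zero_of_addv W hf hadd
  have hT : TameBranchRatDvdAt W p := tameBranchRatDvdAt_of_thmC hC hDel hDelM h5 hcm
  obtain ⟨B, hB, hint⟩ := exists_isTameBranchOf_of_towerBounded_forced hne hã hU0 hC₀
  have hord' : orderOf (χ.ringHomComp (algebraMap ℚ_[p] ℂ_[p])) = tameDefect W p := by
    rw [orderOf_ringHomComp_padicComplex, hχe, tameDefect_of_not_potMult W p hG.1]
  exact charLamLeAt_of_tameBranchRatDvdAt_of_pow_totient_eq hT hp2 hadd (Or.inr hGord) hf hord' hã hB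
    (hint _ hc) hκ heven hord hkφ hval

end SignCert

end TwistPartner

end Summit.BirchSwinnertonDyer.Rank1Residual.Additive

end
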